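import Summits.BirchSwinnertonDyer.Rank1Residual.X11b.ClassClosureTyped
import Summits.BirchSwinnertonDyer.Rank1Residual.X11b.Three.CyclotomicNonsplit
import Literature.Barriers.BirchSwinnertonDyer.PAdicHeightNondegeneracyProofs
import Literature.NumberTheory.EllipticCurves.MordellWeilTheoremProofs
import HarnessLib

/-!
# REG-MULT certificates ⟶ the kernel: the JOIN AT THE SCHNEIDER HALF (census cell
# `bsd-formula-census`, seat conjecture-typer 2, CELL-PLAN §3 H-7; x11b3-lead ruling OWNERS A3.2)

HONEST FRAMING (run/shared/lean/b2b/bsd-rank1-residual/, verbatim in every file): the goal of the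
cell is to DELETE the COMBINATION-SHAPED residual classes of the Birch–Swinnerton-Dyer formula for
ALL analytic-rank `≤ 1` elliptic curves over `ℚ` — "full BSD formula for every rank `≤ 1` curve in
class `C`" assembled STRICTLY from published theorems — so that the rank-`≤ 1` remainder becomes
exactly the CONSTRUCTION-SHAPED classes, which are TYPED (missing-input `Prop`s), NOT attempted.
This is not "finishing BSD". Research route; no claim beyond the stated classes; census / instrument
output = EVIDENCE / certificate rows, never a Literature fact; a REG-MULT row is a per-pair COMPUTED
INPUT (instrumentation tier, like a Kurihara number; booking = referee A / director rulings); the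
class-wide statement — Schneider's non-degeneracy conjecture — is NEVER asserted (barrier file
`Literature/Barriers/BirchSwinnertonDyer/PAdicHeightNondegeneracy`). Nothing below is booked; no label
or RESIDUAL-MAP mark is touched; X11b (N8/O2) stays CONSTRUCTION-SHAPED; every class-level theorem is
CONDITIONAL on the named published facts in its binders and on the certificate hypothesis it names.

## What a REG-MULT row says, and what the kernel wants

A row of the instrument REG-MULT (record format REGMULT-PAIR/v1, `HOME/b2b-bsdres-census-ctyper2/
regmult/REG-MULT-CERT-SCHEMA.md`; STEP-0 = census worker W5, `run/shared/lean/ttrl/bsd-formula-census/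
REGMULT-STEP0.md`, PASS 966/966 two engines, 2026-08-21T05:50Z) certifies, for ONE pair `(E, p)` with
`p ‖ N` and ONE rational point `P` (Cremona's generator; saturation NOT re-proven) with an admissible
multiple `Q = m·P`, that the Stein–Wuthrich 2013 §4.2 height of `Q` is a NON-ZERO `p`-adic number:
at a non-split prime `heightFourOne W p q Q ≠ 0` for THE Tate parameter `q` (SW (4.1), "the same
formula"), at a split prime `heightSplit W p Dq Q ≠ 0` (SW §4.2 display, with Werner's correction
`-log_p(u)²/log_p(q_E)`) — witnessed by `(v, d, A)`: valuation `v`, first unit digit `d ≠ 0`, certified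
absolute precision `A > v`, two engines agreeing on `v` and `≥ 10` unit digits.

The kernel's consumers on the lever locus (`X11b.bsdp_of_ram_nonsplit_of_schneider`,
`X11b.bsdp_of_ram_split_of_five_le_of_schneider` — p249340; `X11b.Three.bsdp_of_classX11b_of_nonsplit_
of_ram_of_schneider` — p250040; `ClassClosure.bsdp_of_leverLocus_of_regulatorNonvanishing` — p249673)
want the hypothesis `hSch : … → SchneiderConjecture Dh` for THE datum `Dh` pinned by
`IsMultCanonical Dh q` / `IsSplitMultCanonical Dh Dq` (= the two halves of
`ClassClosure.RegulatorNonvanishingAt W p`).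

## What this file proves (theorems; two hypothesis-shape `def`s, no fact, no `@[conjecture]`)

1. **Index- and torsion-freeness (rank one).** `schneider_of_pairing_self_ne_zero`: if
   `rank E(ℚ) = 1` and `⟨Q, Q⟩_D ≠ 0` for ANY point `Q`, then `SchneiderConjecture D`; and
   `schneider_iff_forall_pairing_self_ne_zero`: `Reg_p(E, D) ≠ 0 ↔` every point of infinite order is
   anisotropic. (Algebra: `PAdicHeightData.not_schneiderConjecture_iff_of_rank_one` of the barrier
   proofs file + Mordell–Weil `exists_isMordellWeilBasis_holds`.) So a certificate may use any
   non-torsion point and any multiple of it — no generator, no saturation, no index.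
2. **The join, both halves.** `schneider_of_isMultCanonical_of_heightFourOne_ne_zero` /
   `schneider_of_isSplitMultCanonical_of_heightSplit_ne_zero`: THE datum + an admissible `Q` with
   non-zero §4.2 height `⇒ SchneiderConjecture Dh`.
3. **Certificate shapes** `RegMult.CertNonsplit W p P m` / `RegMult.CertSplit W p P m` (exactly the
   row's claim, quantified over THE Tate parameter / THE Tate datum — both unique) and the
   consumer-shaped conclusions: `RegMult.schneiderHalf_nonsplit_of_cert` (the `.1` half of
   `RegulatorNonvanishingAt`, in both binder orders used by the consumers),
   `RegMult.schneiderHalf_split_of_cert` (the `.2` half), and — on a NON-split curve, where the split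
   half is vacuous (`TateParameterData W p` is empty) — the whole predicate
   `RegMult.regulatorNonvanishingAt_of_cert_of_not_split`.
4. **End-to-end consumers with the certificate in place of `hSch`**:
   `RegMult.bsdp_of_ram_nonsplit_of_cert` (every odd `p`, facts of p249340),
   `RegMult.Three.bsdp_of_classX11b_of_nonsplit_of_ram_of_cert` (`p ≥ 3`, facts of p250040 — the
   722 non-split ∧ (ram) TRUE-OPEN X11b classes at `p = 3` of x11b3's sub-partition),
   `RegMult.bsdp_of_ram_split_of_five_le_of_cert` (split, `p ≥ 5`).
5. **What a `ZERO?` row would mean** (anomaly protocol, schema §2): `RegMult.heightFourOne_ne_zero_of_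
   schneider` / `heightSplit_ne_zero_of_schneider` — under `SchneiderConjecture Dh` EVERY admissible
   point has non-zero §4.2 height; so a value genuinely equal to `0` at one admissible point REFUTES
   Schneider's conjecture for THE datum at that pair (never concluded from finite precision: raise `n`).

Nothing here computes a height or asserts a certificate; the 966 STEP-0 rows (N ≤ 3 468, calibration
universe of X11-REPORT v3.1) and the 5 407 production rows (the open X11b cells) live in the census
files, EVIDENCE-labelled. [cite: SteinWuthrich2013, §4.1 eq. (4.1), §4.2 (pp. 15–16), Conj. 4.1]
[cite: Schneider1982PadicHeightI, §1] [cite: MazurSteinTate2006, §1] [cite: Werner1998, Cor. 7.3]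
-/

open scoped Classical MatrixGroups ModularForm

open CongruenceSubgroup WeierstrassCurve Literature.NumberTheory.EllipticCurves
  Literature.NumberTheory.EllipticCurves.ModularForms
  Literature.NumberTheory.EllipticCurves.Rank1Residual
  Literature.NumberTheory.EllipticCurves.Rank1Residual.Typed
  Literature.NumberTheory.EllipticCurves.Rank1Residual.X11RankOneCertificates
  Literature.NumberTheory.EllipticCurves.Skinner2016
  Literature.NumberTheory.EllipticCurves.SteinWuthrich2013
  Literature.NumberTheory.EllipticCurves.Disegni2020
  Literature.Barriers.BirchSwinnertonDyer

namespace Summit.BirchSwinnertonDyer.Rank1Residual.X11b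

/-! ### §1 Rank one: Schneider's conjecture from ONE anisotropic point (index-free) -/

section RankOne

variable {W : WeierstrassCurve ℚ} [W.IsElliptic] {p : ℕ} [Fact p.Prime]

/-- **Rank one: one point with `⟨Q, Q⟩_D ≠ 0` gives `Reg_p(E, D) ≠ 0`.** If `rank E(ℚ) = 1` and
the `D`-height of some point `Q` is non-zero then `SchneiderConjecture D`: otherwise some point of
infinite order is isotropic (`not_schneiderConjecture_iff_of_rank_one`, Mordell–Weil basis from
`exists_isMordellWeilBasis_holds`) and then the pairing vanishes identically in rank one
(`pairing_eq_zero_of_rank_one`). No generator, saturation or index enters. [folklore]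
[cite: MazurTateTeitelbaum1986Invent, §II.4] -/
theorem schneider_of_pairing_self_ne_zero (D : PAdicHeightData W p) (hr : W.mordellWeilRank = 1)
    {Q : W.toAffine.Point} (hQ : D.pairing Q Q ≠ 0) : SchneiderConjecture D := by
  by_contra hS
  obtain ⟨P, hP, hPP⟩ :=
    (D.not_schneiderConjecture_iff_of_rank_one hr W.exists_isMordellWeilBasis_holds).mp hS
  exact hQ (D.pairing_eq_zero_of_rank_one hr hP hPP Q Q)

/-- **Rank one: `Reg_p(E, D) ≠ 0 ↔` every point of infinite order is `D`-anisotropic.** [folklore]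
[cite: MazurTateTeitelbaum1986Invent, §II.4] -/
theorem schneider_iff_forall_pairing_self_ne_zero (D : PAdicHeightData W p)
    (hr : W.mordellWeilRank = 1) :
    SchneiderConjecture D ↔ ∀ P : W.toAffine.Point, ¬ IsOfFinAddOrder P → D.pairing P P ≠ 0 := by
  constructor
  · intro hS P hP hPP
    exact (D.not_schneiderConjecture_of_rank_one hr hP hPP) hS
  · intro h
    by_contra hS
    obtain ⟨P, hP, hPP⟩ :=
      (D.not_schneiderConjecture_iff_of_rank_one hr W.exists_isMordellWeilBasis_holds).mp hS
    exact h P hP hPP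

omit [W.IsElliptic] in
/-- **The height of a multiple**: `⟨m·P, m·P⟩_D = m²·⟨P, P⟩_D` (bilinearity), so feeding `2P` instead
of `P` multiplies a certificate's value by exactly `4` (the planted control of REGMULT STEP-0) and
never changes (non-)vanishing. [folklore] -/
theorem pairing_nsmul_nsmul (D : PAdicHeightData W p) (P : W.toAffine.Point) (m : ℕ) :
    D.pairing (m • P) (m • P) = ((m : ℚ_[p]) * m) * D.pairing P P := by
  rw [map_nsmul, D.symm (m • P) P, map_nsmul, smul_smul, nsmul_eq_mul, Nat.cast_mul]

/-- In analytic rank one `rank E(ℚ) = 1` (GZK, binder `hGZK`) — the rank hypothesis of this file in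
the consumers' currency. [cite: KolyvaginEulerSystems1990, Thm. A] -/
theorem mordellWeilRank_eq_one_of_analyticRank (hGZK : rank_eq_analyticRank_of_analyticRank_le_one)
    (hr : W.analyticRank = 1) : W.mordellWeilRank = 1 := by
  rw [(hGZK W hr.le).1, hr]

end RankOne

/-! ### §2 The join: THE §4.2 datum + one admissible point of non-zero height ⇒ Schneider -/

section Join

variable {W : WeierstrassCurve ℚ} [W.IsElliptic] [W.IsGloballyMinimal] {p : ℕ} [Fact p.Prime]

omit [W.IsGloballyMinimal] in
/-- **Non-split half of the join.** For THE Stein–Wuthrich height at a non-split multiplicative prime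
(`IsMultCanonical Dh q`: its quadratic form is formula (4.1) on admissible points), an admissible point
`Q` with `heightFourOne W p q Q ≠ 0` on a curve of Mordell–Weil rank one gives `SchneiderConjecture Dh`.
This is exactly what one REGMULT-PAIR/v1 row (non-split) supplies. [cite: SteinWuthrich2013, §4.2 (p. 15)]
[cite: Schneider1982PadicHeightI, §1] -/
theorem schneider_of_isMultCanonical_of_heightFourOne_ne_zero (hr : W.mordellWeilRank = 1)
    {q : ℚ_[p]} {Dh : PAdicHeightData W p} (hDh : IsMultCanonical Dh q) {Q : W.toAffine.Point}
    (hadm : W.IsAdmissible p Q) (hne : heightFourOne W p q Q ≠ 0) : SchneiderConjecture Dh :=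
  schneider_of_pairing_self_ne_zero Dh hr (by rw [hDh Q hadm]; exact hne)

omit [W.IsGloballyMinimal] in
/-- **Split half of the join.** For THE modified §4.2 height at a split multiplicative prime
(`IsSplitMultCanonical Dh Dq`), an admissible `Q` with `heightSplit W p Dq Q ≠ 0` in rank one gives
`SchneiderConjecture Dh`. [cite: SteinWuthrich2013, §4.2 (p. 16)] [cite: Werner1998, Cor. 7.3] -/
theorem schneider_of_isSplitMultCanonical_of_heightSplit_ne_zero (hr : W.mordellWeilRank = 1)
    {Dq : TateParameterData W p} {Dh : PAdicHeightData W p} (hDh : IsSplitMultCanonical Dh Dq)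
    {Q : W.toAffine.Point} (hadm : W.IsAdmissible p Q) (hne : heightSplit W p Dq Q ≠ 0) :
    SchneiderConjecture Dh :=
  schneider_of_pairing_self_ne_zero Dh hr (by rw [hDh Q hadm]; exact hne)

omit [W.IsGloballyMinimal] in
/-- **Converse (meaning of a `ZERO?` row), non-split.** Under `SchneiderConjecture Dh` for THE datum,
EVERY admissible point has non-zero (4.1)-height; so an exactly-zero value at one admissible point
would refute Schneider's conjecture for THE height at this pair. [cite: SteinWuthrich2013, §4.2, Conj. 4.1] -/
theorem heightFourOne_ne_zero_of_schneider (hr : W.mordellWeilRank = 1) {q : ℚ_[p]}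
    {Dh : PAdicHeightData W p} (hDh : IsMultCanonical Dh q) (hS : SchneiderConjecture Dh)
    {Q : W.toAffine.Point} (hadm : W.IsAdmissible p Q) : heightFourOne W p q Q ≠ 0 := by
  rw [← hDh Q hadm]
  exact (schneider_iff_forall_pairing_self_ne_zero Dh hr).mp hS Q hadm.1

omit [W.IsGloballyMinimal] in
/-- **Converse, split.** [cite: SteinWuthrich2013, §4.2, Conj. 4.1] -/
theorem heightSplit_ne_zero_of_schneider (hr : W.mordellWeilRank = 1) {Dq : TateParameterData W p}
    {Dh : PAdicHeightData W p} (hDh : IsSplitMultCanonical Dh Dq) (hS : SchneiderConjecture Dh)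
    {Q : W.toAffine.Point} (hadm : W.IsAdmissible p Q) : heightSplit W p Dq Q ≠ 0 := by
  rw [← hDh Q hadm]
  exact (schneider_iff_forall_pairing_self_ne_zero Dh hr).mp hS Q hadm.1

end Join

/-! ### §3 Certificate shapes (REGMULT-PAIR/v1) and the consumers' `hSch` -/

namespace RegMult

section Shapes

variable (W : WeierstrassCurve ℚ) [W.IsElliptic] (p : ℕ) [Fact p.Prime]

/-- **REGMULT-PAIR/v1 certificate, NON-SPLIT half** — the exact claim of one row `(E, p, P, m)`:
`m·P` is admissible and the Stein–Wuthrich (4.1) height of `m·P` is non-zero for THE Tate parameter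
(`q ≠ 0`, `‖q‖ < 1`, `j(q) = j(E)`; unique, `existsUnique_tateJ_eq_holds`, so the `∀ q` ranges over one
number — the row's own `q`, pinned by two engines to `≥ 24` digits in STEP-0). A hypothesis SHAPE with
data `(P, m)`; instantiated per pair by a census row (EVIDENCE, instrumentation tier); nothing asserted.
[cite: SteinWuthrich2013, §4.2 (p. 15)] -/
def CertNonsplit (P : W.toAffine.Point) (m : ℕ) : Prop :=
  W.IsAdmissible p (m • P) ∧
    ∀ q : ℚ_[p], q ≠ 0 → ‖q‖ < 1 → tateJ q = (W.j : ℚ_[p]) → heightFourOne W p q (m • P) ≠ 0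

/-- **REGMULT-PAIR/v1 certificate, SPLIT half**: `m·P` admissible and the modified §4.2 height of
`m·P` non-zero for THE Tate datum (`TateParameterData W p`, unique `q_E`: `TateParameterData.q_unique`).
Hypothesis shape; nothing asserted. [cite: SteinWuthrich2013, §4.2 (p. 16)] -/
def CertSplit (P : W.toAffine.Point) (m : ℕ) : Prop :=
  W.IsAdmissible p (m • P) ∧ ∀ Dq : TateParameterData W p, heightSplit W p Dq (m • P) ≠ 0

end Shapes

section Halves

variable {W : WeierstrassCurve ℚ} [W.IsElliptic] {p : ℕ} [Fact p.Prime]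

/-- **Non-split certificate ⇒ the `.1` half of `ClassClosure.RegulatorNonvanishingAt W p`** (binder
order of p249340 / p249673: `∀ q Dh, …`), in Mordell–Weil rank one. [cite: SteinWuthrich2013, §4.2] -/
theorem schneiderHalf_nonsplit_of_cert (hr : W.mordellWeilRank = 1) {P : W.toAffine.Point} {m : ℕ}
    (hc : CertNonsplit W p P m) :
    ∀ (q : ℚ_[p]) (Dh : PAdicHeightData W p), q ≠ 0 → ‖q‖ < 1 → tateJ q = (W.j : ℚ_[p]) →
      IsMultCanonical Dh q → SchneiderConjecture Dh :=
  fun q _ hq0 hq1 hqj hDh =>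
    schneider_of_isMultCanonical_of_heightFourOne_ne_zero hr hDh hc.1 (hc.2 q hq0 hq1 hqj)

/-- The same in the binder order of p250040 (`∀ q, … → ∀ Dh, …`). [cite: SteinWuthrich2013, §4.2] -/
theorem schneiderHalf_nonsplit_of_cert' (hr : W.mordellWeilRank = 1) {P : W.toAffine.Point} {m : ℕ}
    (hc : CertNonsplit W p P m) :
    ∀ q : ℚ_[p], q ≠ 0 → ‖q‖ < 1 → tateJ q = (W.j : ℚ_[p]) →
      ∀ Dh : PAdicHeightData W p, IsMultCanonical Dh q → SchneiderConjecture Dh :=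
  fun q hq0 hq1 hqj Dh hDh => schneiderHalf_nonsplit_of_cert hr hc q Dh hq0 hq1 hqj hDh

/-- **Split certificate ⇒ the `.2` half of `ClassClosure.RegulatorNonvanishingAt W p`.**
[cite: SteinWuthrich2013, §4.2] -/
theorem schneiderHalf_split_of_cert (hr : W.mordellWeilRank = 1) {P : W.toAffine.Point} {m : ℕ}
    (hc : CertSplit W p P m) :
    ∀ (Dq : TateParameterData W p) (Dh : PAdicHeightData W p),
      IsSplitMultCanonical Dh Dq → SchneiderConjecture Dh :=
  fun Dq _ hDh => schneider_of_isSplitMultCanonical_of_heightSplit_ne_zero hr hDh hc.1 (hc.2 Dq)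

/-- **On a NON-split curve one non-split certificate gives the whole bundled predicate
`ClassClosure.RegulatorNonvanishingAt W p`**: its split half quantifies over `TateParameterData W p`,
which is EMPTY when the reduction is not split (`nonempty_tateParameterData_iff_holds`). (On a split
curve the converse service is not available: the `.1` half there quantifies over data
`IsMultCanonical Dh q` that no certificate addresses — schema §3 remark; consumers use `.2`.)
[cite: SteinWuthrich2013, §4.2] -/
theorem regulatorNonvanishingAt_of_cert_of_not_split (hr : W.mordellWeilRank = 1)
    (hns : ¬ W.HasSplitMultiplicativeReductionAtPrime p) {P : W.toAffine.Point} {m : ℕ}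
    (hc : CertNonsplit W p P m) : ClassClosure.RegulatorNonvanishingAt W p := by
  refine ⟨schneiderHalf_nonsplit_of_cert hr hc, fun Dq _ _ => ?_⟩
  exact absurd ((nonempty_tateParameterData_iff_holds (W := W) (p := p)).mp ⟨Dq⟩) hns

/-- A certificate fed with `P` is a certificate fed with any multiple: `CertNonsplit W p P (k*m)` from
`CertNonsplit W p (k • P) m` (bookkeeping for rows whose point is a multiple of Cremona's generator;
`(k*m)•P = m•(k•P)`). [folklore] -/
theorem certNonsplit_of_nsmul {P : W.toAffine.Point} {k m : ℕ} (hc : CertNonsplit W p (k • P) m) :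
    CertNonsplit W p P (m * k) := by
  simpa only [CertNonsplit, mul_smul] using hc

end Halves

/-! ### §4 End-to-end: `BSD(E,p)` on the lever locus with the certificate in place of `hSch` -/

section Consumers

variable (W : WeierstrassCurve ℚ) [W.IsElliptic] [W.IsGloballyMinimal] (p : ℕ) [Fact p.Prime]

omit [W.IsGloballyMinimal] in
/-- **Both certificates ⇒ the bundled predicate `ClassClosure.RegulatorNonvanishingAt W p`** (any
reduction type; a seat holding a (4.1)-row AND a modified-height row for the same pair).
[cite: SteinWuthrich2013, §4.2] -/
theorem regulatorNonvanishingAt_of_certs (hr : W.mordellWeilRank = 1) {P P' : W.toAffine.Point}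
    {m m' : ℕ} (hc : CertNonsplit W p P m) (hc' : CertSplit W p P' m') :
    ClassClosure.RegulatorNonvanishingAt W p :=
  ⟨schneiderHalf_nonsplit_of_cert hr hc, schneiderHalf_split_of_cert hr hc'⟩

/-- **(ram) ∧ NON-SPLIT at every odd `p` (the lever locus, `p = 3` included): `BSD(E,p)` from the
PUBLISHED named facts of cc-typer-3's verbatim-extension theorem
`ClassClosure.bsdp_of_leverLocus_of_regulatorNonvanishing` (Skinner 2016 Thm. A `hA`, SW 2013 Thm. 6.1
`hJn hJs`, SW §4.2 height existence `hHn hHs`, Disegni 2020 Thm. 1 `hD`, GZK `hGZK`, modularity `hpar`)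
and ONE REGMULT certificate `CertNonsplit W p P m` — which, the curve being non-split at `p`, yields the
whole per-pair input `RegulatorNonvanishingAt W p` (`regulatorNonvanishingAt_of_cert_of_not_split`).**
CONDITIONAL on the facts; the certificate is a per-pair computed input (EVIDENCE, instrumentation tier);
nothing booked; X11b stays CONSTRUCTION-SHAPED. [cite: Skinner2016PacificMC, Thm. A]
[cite: SteinWuthrich2013, Thm. 6.1, §4.2] [cite: Disegni2020, Thm. 1 (§1.2)] [cite: Miller2011LMS, Def. 1.1] -/
theorem bsdp_of_ram_nonsplit_of_cert (hA : thmA_charIdeal_multiplicative)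
    (hJn : thm61_nonsplitMultiplicative) (hJs : thm61_splitMultiplicative)
    (hHn : exists_isMultCanonical) (hHs : exists_isSplitMultCanonical)
    (hD : thm1_padicBSD_rankOne_multiplicative)
    (hGZK : rank_eq_analyticRank_of_analyticRank_le_one) (hpar : nonempty_modularParametrizationData)
    (hX : ClassX11b W p) (hns : ¬ W.HasSplitMultiplicativeReductionAtPrime p) (hram : Ram W p)
    {P : W.toAffine.Point} {m : ℕ} (hc : CertNonsplit W p P m) : BSDp W p :=
  ClassClosure.bsdp_of_leverLocus_of_regulatorNonvanishing W p hA hJn hJs hHn hHs hD hGZK hpar hX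
    (ClassClosure.leverLocusAt_of_ram_of_nonsplit W p hram hns)
    (regulatorNonvanishingAt_of_cert_of_not_split (mordellWeilRank_eq_one_of_analyticRank hGZK hX.1)
      hns hc)

/-- **x11b3's 722 TRUE-OPEN non-split ∧ (ram) classes at `p = 3` (and every `p ≥ 3`), in the currency
of the team's consumer of record p250040: `BSD(E,p)` from its published facts (`hA hJ hD hH hLns hGZK
hpar`) and ONE REGMULT certificate**, which discharges `hSch` of
`X11b.Three.bsdp_of_classX11b_of_nonsplit_of_ram_of_schneider`. CONDITIONAL; nothing booked; O2 OPEN.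
[cite: Skinner2016PacificMC, Thm. A] [cite: SteinWuthrich2013, Thm. 6.1, §4.2] [cite: Disegni2020, Thm. 1] -/
theorem Three.bsdp_of_classX11b_of_nonsplit_of_ram_of_cert (hA : thmA_charIdeal_multiplicative)
    (hJ : thm61_nonsplitMultiplicative) (hD : thm1_padicBSD_nonsplitMultiplicative)
    (hH : exists_isMultCanonical) (hLns : exists_isMultPAdicLFunctionOf_neg_one)
    (hGZK : rank_eq_analyticRank_of_analyticRank_le_one) (hpar : nonempty_modularParametrizationData)
    (hp : 3 ≤ p) (hX : ClassX11b W p) (hns : ¬ W.HasSplitMultiplicativeReductionAtPrime p)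
    (hram : Ram W p) {P : W.toAffine.Point} {m : ℕ} (hc : CertNonsplit W p P m) : BSDp W p :=
  X11b.Three.bsdp_of_classX11b_of_nonsplit_of_ram_of_schneider hA hJ hD hH hLns hGZK hpar W p hp hX
    hns hram (schneiderHalf_nonsplit_of_cert' (mordellWeilRank_eq_one_of_analyticRank hGZK hX.1) hc)

/-- **(ram) ∧ SPLIT at `p ≥ 5` (the lever locus, split side): `BSD(E,p)` from the same PUBLISHED named
facts and ONE REGMULT certificate `CertSplit W p P m`** discharging the split half `hSch` of
`X11b.bsdp_of_ram_split_of_five_le_of_schneider` (Disegni's hypothesis (∗) = the (ram) prime, as in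
`bsdp_of_leverLocus_of_regulatorNonvanishing`). CONDITIONAL; nothing booked.
[cite: Skinner2016PacificMC, Thm. A] [cite: SteinWuthrich2013, Thm. 6.1, §4.2] [cite: Disegni2020, Thm. 1, (∗)] -/
theorem bsdp_of_ram_split_of_five_le_of_cert (hA : thmA_charIdeal_multiplicative)
    (hJs : thm61_splitMultiplicative) (hHs : exists_isSplitMultCanonical)
    (hD : thm1_padicBSD_rankOne_multiplicative)
    (hGZK : rank_eq_analyticRank_of_analyticRank_le_one) (hpar : nonempty_modularParametrizationData)
    (hX : ClassX11b W p) (hsplit : W.HasSplitMultiplicativeReductionAtPrime p) (hp5 : 5 ≤ p)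
    (hram : Ram W p) {P : W.toAffine.Point} {m : ℕ} (hc : CertSplit W p P m) : BSDp W p :=
  bsdp_of_ram_split_of_five_le_of_schneider W p hA hJs hHs hGZK hpar
    (fun hf ϖ hϖ0 hϖ hp5' hm Dq L hL Dh hDh =>
      thm1_padicBSD_rankOne_multiplicative.split hD W p hX.2.1 hX.2.2.1 hX.1 hf ϖ hϖ0 hϖ hsplit hp5'
        hm Dq L hL Dh hDh)
    hX hsplit hram hp5 (schneiderHalf_split_of_cert (mordellWeilRank_eq_one_of_analyticRank hGZK hX.1) hc)

/-- **The lever locus in one statement with certificates in place of the bundled input**: for an X11b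
pair on `LeverLocusAt W p` (a (ram) prime; `p ≥ 5` if split), `BSD(E,p)` from the published facts and
the certificate matching the reduction type (`hcn` used iff non-split, `hcs` iff split). CONDITIONAL;
nothing booked. [cite: Skinner2016PacificMC, Thm. A] [cite: SteinWuthrich2013, Thm. 6.1, §4.2]
[cite: Disegni2020, Thm. 1 (§1.2), (∗)] -/
theorem bsdp_of_leverLocus_of_cert (hA : thmA_charIdeal_multiplicative)
    (hJn : thm61_nonsplitMultiplicative) (hJs : thm61_splitMultiplicative)
    (hHn : exists_isMultCanonical) (hHs : exists_isSplitMultCanonical)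
    (hD : thm1_padicBSD_rankOne_multiplicative)
    (hGZK : rank_eq_analyticRank_of_analyticRank_le_one) (hpar : nonempty_modularParametrizationData)
    (hX : ClassX11b W p) (hloc : ClassClosure.LeverLocusAt W p) {P : W.toAffine.Point} {m : ℕ}
    (hcn : ¬ W.HasSplitMultiplicativeReductionAtPrime p → CertNonsplit W p P m)
    (hcs : W.HasSplitMultiplicativeReductionAtPrime p → CertSplit W p P m) : BSDp W p := by
  by_cases hsplit : W.HasSplitMultiplicativeReductionAtPrime p
  · exact bsdp_of_ram_split_of_five_le_of_cert W p hA hJs hHs hD hGZK hpar hX hsplit (hloc.2 hsplit)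
      hloc.1 (hcs hsplit)
  · exact bsdp_of_ram_nonsplit_of_cert W p hA hJn hJs hHn hHs hD hGZK hpar hX hsplit hloc.1 (hcn hsplit)

end Consumers

end RegMult

end Summit.BirchSwinnertonDyer.Rank1Residual.X11b
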